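import Literature.Computability.Complexity.RossmanMonotoneCliqueSparseNoise
import Literature.Computability.Complexity.RossmanMonotoneCliqueProofs
import HarnessLib

/-!
# Rossman 2010, Theorem 1 with sparse noise: the asymptotic corollary

The sequence form of the sparse-noise variant of Theorem 1 of

* B. Rossman, *The monotone complexity of k-clique on random graphs*, FOCS 2010, pp. 193–201
  (full version 2009; SIAM J. Comput. 43 (2014) 256–279) [Rossman2010],

obtained from the finite dichotomy `thm1_sparse_finite` of
`RossmanMonotoneCliqueSparseNoise.lean` (class parameter `k'` decoupled from the clique size
`k`; Lemma 15 replaced by a count of the non-empty small minterms of the output) by the choice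
of parameters

* noise density `p = n^{-ρ}`, closedness threshold `t = tThr δ n = exp(-n^δ)`, `ρ, δ > 0`,
  `ρ + δ ≤ 2/k'`, and `k' ≥ 4(c + 1)` for circuits of size `≤ n^c`,

and the verification that both weight sums of the dichotomy are then `O(n^{-1})`:

* `sigWeight_le_rpow` — `W(v,s) = (B log(s/t)/p)^s (k/n)^v ≤ (2B)^{K²} k^K n^{(ρ+δ)s - v}` for
  `1 ≤ s ≤ K²`, `v ≤ K`, once `log K² ≤ n^δ` (Lemma 9's bound `n^{s(2/(k-1)+2δ)}` at a free
  density exponent);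
* `exponent_smallI_le` — over the non-empty small patterns (`1 ≤ s ≤ C(v,2)`, `v ≤ K`):
  `(ρ+δ)s - v ≤ -1` as soon as `ρ + δ ≤ 2/K` (the inequality `(v-1)(v-K) ≤ 0`);
* `exponent_medJ_le` — over `J` (signature inequality `medJ_ineq`:
  `K² + 7 + 8s + 4v ≤ 4Kv`): `c + (ρ+δ)s - v ≤ -1` as soon as `ρ + δ ≤ 2/K` and `4(c+1) ≤ K`
  (Rossman's "`supp(H) - (2/(k-1))|E_H| > k/4`" at the end of §6, with `k'` for `k`);
* `card_image_sig_le_of_supp_lt`, `sum_sigWeight_smallI_le`, `rpow_mul_sum_sigWeight_medJ_le`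
  — the two sums are `≤ k'(k'²+1) (2B)^{k'²} k^{k'} n^{-1}`, the second one even after
  multiplication by `n^c`;
* `thm1_sparse` — **the sparse-noise Theorem 1**: for `5 ≤ k'`, `4(c+1) ≤ k' ≤ k`,
  `0 < ρ`, `0 < δ`, `ρ + δ ≤ 2/k'` and `η > 0`, for all large `n`, every circuit `C` over
  `{∧₂, ∨₂, 0, 1}` on the edges of `Kₙ` with `size C ≤ n^c` and `Pr_A[C(K_A) = 1] ≥ η`
  (`A` a uniformly random `k`-set) satisfies `Pr[C(G(n, n^{-ρ})) = 1] ≥ 1 - exp(-n^{δ/2})`;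
  `thm1_sparse_natSize` is the same for `c : ℕ` and the size bound `size C ≤ n ^ c` in `ℕ`.

Informally: a monotone circuit of size `n^c` accepting a constant fraction of the planted
`k`-cliques accepts the pure noise `G(n, n^{-ρ})` asymptotically almost surely for every
`ρ < 2/k'` (`= 1/(2(c+1))` for `k' = 4(c+1)`) — a noise exponent depending on the size exponent
`c` only, NOT on `k` (Theorem 1 itself: `ρ = 2(1+δ)/(k-1)`). Here `k`, `k'`, `c`, `ρ`, `δ`, `η`
are constants
and the threshold in `n` depends on all of them; nothing is claimed for `k` growing with `n`,
and nothing relative to a background graph.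

Provenance: a corollary of the variant `thm1_sparse_finite` (whose I-count replacing Lemma 15
is not in the source); the exponent bookkeeping is the end of §6 of the paper with `k'` in place
of `k`. Tagged as a variant of Theorem 1.

## References

* [Rossman2010] B. Rossman, The monotone complexity of k-clique on random graphs, FOCS 2010,
  193–201; SIAM J. Comput. 43 (2014) 256–279 — Theorem 1 (p. 4), Lemma 9 (p. 7), §6 (p. 9).
-/

noncomputable section

namespace Literature.Computability.Complexity

open Finset Filter GateList Literature.Combinatorics.SetFamily
open scoped Classical

/-! ### The signature weights at density `n^{-ρ}` and threshold `exp(-n^δ)` -/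

/-- **Lemma 9's bound at a free density exponent**: for `p = n^{-ρ}`, `t = exp(-n^δ)`, `n ≥ 1`,
`k ≥ 1`, `log K² ≤ n^δ` and a signature `(v, s)` with `1 ≤ s ≤ K²`, `v ≤ K`,
`(B log(s/t)/p)^s (k/n)^v ≤ (2B)^{K²} k^K n^{(ρ+δ)s - v}` (as in `sigWeight_le`:
`log(s/t) ≤ 2n^δ`, `1/p = n^ρ`). [cite: Rossman2010, Lemma 9 and §6 (pp. 7, 9)] -/
theorem sigWeight_le_rpow {n k K v s : ℕ} (hn1 : 1 ≤ n) (hk1 : 1 ≤ k) {ρ δ : ℝ}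
    (hlog : Real.log ((K : ℝ) ^ 2) ≤ (n : ℝ) ^ δ) (hs1 : 1 ≤ s) (hsK : s ≤ K ^ 2)
    (hvK : v ≤ K) :
    sigWeight n k ((n : ℝ) ^ (-ρ)) (tThr δ n) (v, s) ≤
      (2 * spreadConst) ^ (K ^ 2) * (k : ℝ) ^ K * (n : ℝ) ^ ((ρ + δ) * s - v) := by
  -- adapted from `sigWeight_le` (RossmanMonotoneCliqueFinite.lean)
  have hn' : (1 : ℝ) ≤ n := by exact_mod_cast hn1
  have hn0 : (0 : ℝ) < n := by linarith
  have hk' : (1 : ℝ) ≤ k := by exact_mod_cast hk1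
  have hB1 : (1 : ℝ) ≤ 2 * spreadConst := by rw [spreadConst]; norm_num
  have hspos : (0 : ℝ) < s := by exact_mod_cast hs1
  have hsK' : (s : ℝ) ≤ (K : ℝ) ^ 2 := by exact_mod_cast hsK
  -- `0 ≤ log(s/t) ≤ 2 n^δ`
  have hlogs : Real.log s ≤ (n : ℝ) ^ δ := (Real.log_le_log hspos hsK').trans hlog
  have hlogst : Real.log (s / tThr δ n) ≤ 2 * (n : ℝ) ^ δ := by
    rw [tThr, Real.log_div hspos.ne' (Real.exp_pos _).ne', Real.log_exp]; linarith
  have hlog0 : 0 ≤ Real.log (s / tThr δ n) := by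
    rw [tThr, Real.log_div hspos.ne' (Real.exp_pos _).ne', Real.log_exp]
    have : 0 ≤ Real.log s := Real.log_nonneg (by exact_mod_cast hs1)
    have : 0 ≤ (n : ℝ) ^ δ := Real.rpow_nonneg hn0.le δ
    linarith
  -- `1/p = n^ρ`
  have hpinv : ((n : ℝ) ^ (-ρ))⁻¹ = (n : ℝ) ^ ρ := by rw [Real.rpow_neg hn0.le, inv_inv]
  have hp0 : 0 < (n : ℝ) ^ (-ρ) := Real.rpow_pos_of_pos hn0 _
  -- the base
  have hbase : spreadConst * Real.log (s / tThr δ n) / (n : ℝ) ^ (-ρ) ≤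
      2 * spreadConst * (n : ℝ) ^ (ρ + δ) := by
    rw [div_eq_mul_inv, hpinv, add_comm, Real.rpow_add hn0]
    have h1 : spreadConst * Real.log (s / tThr δ n) ≤ spreadConst * (2 * (n : ℝ) ^ δ) :=
      mul_le_mul_of_nonneg_left hlogst spreadConst_pos.le
    have h2 : 0 ≤ (n : ℝ) ^ ρ := Real.rpow_nonneg hn0.le _
    calc spreadConst * Real.log (s / tThr δ n) * (n : ℝ) ^ ρ
        ≤ spreadConst * (2 * (n : ℝ) ^ δ) * (n : ℝ) ^ ρ := mul_le_mul_of_nonneg_right h1 h2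
      _ = 2 * spreadConst * ((n : ℝ) ^ δ * (n : ℝ) ^ ρ) := by ring
  have hbase0 : 0 ≤ spreadConst * Real.log (s / tThr δ n) / (n : ℝ) ^ (-ρ) :=
    div_nonneg (mul_nonneg spreadConst_pos.le hlog0) hp0.le
  -- the power
  have hpow : (spreadConst * Real.log (s / tThr δ n) / (n : ℝ) ^ (-ρ)) ^ s ≤
      (2 * spreadConst) ^ (K ^ 2) * (n : ℝ) ^ ((ρ + δ) * s) := by
    calc (spreadConst * Real.log (s / tThr δ n) / (n : ℝ) ^ (-ρ)) ^ s
        ≤ (2 * spreadConst * (n : ℝ) ^ (ρ + δ)) ^ s := pow_le_pow_left₀ hbase0 hbase s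
      _ = (2 * spreadConst) ^ s * (n : ℝ) ^ ((ρ + δ) * s) := by
          rw [mul_pow, ← Real.rpow_natCast ((n : ℝ) ^ (ρ + δ)) s, ← Real.rpow_mul hn0.le]
      _ ≤ (2 * spreadConst) ^ (K ^ 2) * (n : ℝ) ^ ((ρ + δ) * s) :=
          mul_le_mul_of_nonneg_right (pow_le_pow_right₀ hB1 hsK) (Real.rpow_nonneg hn0.le _)
  have hkv : ((k : ℝ) / n) ^ v = (k : ℝ) ^ v * (n : ℝ) ^ (-(v : ℝ)) := by
    rw [div_pow, Real.rpow_neg hn0.le, Real.rpow_natCast, div_eq_mul_inv]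
  have hkk : (k : ℝ) ^ v ≤ (k : ℝ) ^ K := pow_le_pow_right₀ hk' hvK
  have hB0 : (0 : ℝ) ≤ 2 * spreadConst := by linarith
  rw [sigWeight]
  dsimp only
  rw [hkv]
  calc (spreadConst * Real.log (s / tThr δ n) / (n : ℝ) ^ (-ρ)) ^ s *
        ((k : ℝ) ^ v * (n : ℝ) ^ (-(v : ℝ)))
      ≤ (2 * spreadConst) ^ (K ^ 2) * (n : ℝ) ^ ((ρ + δ) * s) *
          ((k : ℝ) ^ K * (n : ℝ) ^ (-(v : ℝ))) := by
        refine mul_le_mul hpow (mul_le_mul_of_nonneg_right hkk (Real.rpow_nonneg hn0.le _)) ?_ ?_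
        · exact mul_nonneg (pow_nonneg (by linarith) _) (Real.rpow_nonneg hn0.le _)
        · exact mul_nonneg (pow_nonneg hB0 _) (Real.rpow_nonneg hn0.le _)
    _ = (2 * spreadConst) ^ (K ^ 2) * (k : ℝ) ^ K * (n : ℝ) ^ ((ρ + δ) * s - v) := by
        rw [sub_eq_add_neg, Real.rpow_add hn0]; ring

/-! ### Exponent bookkeeping -/

/-- **The exponent over the non-empty small patterns**: if `1 ≤ s ≤ C(v,2)`, `v ≤ K` and
`a ≤ 2/K`, then `a·s - v ≤ -1` (since `2s ≤ v² - v` and `(v-1)(v-K) ≤ 0`). [folklore] -/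
theorem exponent_smallI_le {K v s : ℕ} {a : ℝ} (haK : a ≤ 2 / (K : ℝ)) (hs1 : 1 ≤ s)
    (hsv : s ≤ v.choose 2) (hvK : v ≤ K) : a * s - v ≤ -1 := by
  have hv2 : 2 ≤ v := by
    by_contra h
    rw [not_le] at h
    rw [Nat.choose_eq_zero_of_lt h] at hsv
    omega
  have hK0 : (0 : ℝ) < K := by exact_mod_cast (show 0 < K by omega)
  have hcz := two_mul_choose_two_add v
  have hs' : 2 * (s : ℝ) ≤ (v : ℝ) * v - v := by
    have h1 : 2 * s + v ≤ v * v := by omega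
    have : ((2 * s + v : ℕ) : ℝ) ≤ ((v * v : ℕ) : ℝ) := by exact_mod_cast h1
    push_cast at this
    linarith
  have hv1' : (1 : ℝ) ≤ v := by exact_mod_cast (show 1 ≤ v by omega)
  have hvK' : (v : ℝ) ≤ K := by exact_mod_cast hvK
  have has : a * s ≤ 2 / (K : ℝ) * s := mul_le_mul_of_nonneg_right haK (Nat.cast_nonneg _)
  have h2 : 2 / (K : ℝ) * s ≤ ((v : ℝ) * v - v) / K := by
    rw [div_mul_eq_mul_div, div_le_div_iff_of_pos_right hK0]
    exact hs'
  have h3 : ((v : ℝ) * v - v) / K ≤ v - 1 := by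
    rw [div_le_iff₀ hK0]
    nlinarith [mul_nonneg (sub_nonneg.2 hv1') (sub_nonneg.2 hvK')]
  linarith

/-- **The exponent over `J`** (end of §6 with `K` for `k`: "`supp(H) - (2/(k-1))|E_H| > k/4`"):
if `K² + 7 + 8s + 4v ≤ 4Kv` (`medJ_ineq`), `a ≤ 2/K` and `4(c+1) ≤ K`, then
`c + a·s - v ≤ -1`. [cite: Rossman2010, §6 (p. 9)] -/
theorem exponent_medJ_le {K v s : ℕ} {a c : ℝ} (haK : a ≤ 2 / (K : ℝ))
    (hcK : 4 * (c + 1) ≤ (K : ℝ)) (hJ : K ^ 2 + 7 + 8 * s + 4 * v ≤ 4 * K * v) :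
    c + a * s - v ≤ -1 := by
  have hK : 0 < K := by
    rcases Nat.eq_zero_or_pos K with rfl | hK
    · norm_num at hJ
    · exact hK
  have hK0 : (0 : ℝ) < K := by exact_mod_cast hK
  have hJ' : ((K ^ 2 + 7 + 8 * s + 4 * v : ℕ) : ℝ) ≤ ((4 * K * v : ℕ) : ℝ) := by
    exact_mod_cast hJ
  push_cast at hJ'
  have has : a * s ≤ 2 / (K : ℝ) * s := mul_le_mul_of_nonneg_right haK (Nat.cast_nonneg _)
  have h2 : 2 / (K : ℝ) * s ≤ v - K / 4 := by
    rw [div_mul_eq_mul_div, div_le_iff₀ hK0]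
    nlinarith
  linarith

/-- At most `K (K² + 1)` signatures occur among graphs with fewer than `K` non-isolated
vertices (a box bound, as in `card_image_sig_medJ_le`). [folklore] -/
theorem card_image_sig_le_of_supp_lt {n K : ℕ}
    {P : Finset ((⊤ : SimpleGraph (Fin n)).edgeSet → Bool)} (hP : ∀ H ∈ P, #(supp H) < K) :
    #(P.image sig) ≤ K * (K ^ 2 + 1) := by
  have : P.image sig ⊆ range K ×ˢ range (K ^ 2 + 1) := by
    intro σ hσ
    obtain ⟨H, hH, rfl⟩ := mem_image.1 hσ
    have hvk := hP H hH
    have hsv := card_onSet_le_choose H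
    have h2 := two_mul_choose_two_add #(supp H)
    rw [mem_product, mem_range, mem_range, sig]
    refine ⟨hvk, ?_⟩
    have : (#(supp H)).choose 2 ≤ #(supp H) * #(supp H) := by omega
    have : #(supp H) * #(supp H) ≤ K * K := Nat.mul_le_mul (by omega) (by omega)
    calc #(onSet H) ≤ K * K := by omega
      _ < K ^ 2 + 1 := by rw [sq]; omega
  refine (card_le_card this).trans ?_
  rw [card_product, card_range, card_range]

/-- `|E_H| ≤ K²` for a graph with at most `K` non-isolated vertices. [folklore] -/
theorem card_onSet_le_sq {n K : ℕ} {H : (⊤ : SimpleGraph (Fin n)).edgeSet → Bool}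
    (hvK : #(supp H) ≤ K) : #(onSet H) ≤ K ^ 2 := by
  have hsv := card_onSet_le_choose H
  have h2 := two_mul_choose_two_add #(supp H)
  have : #(supp H) * #(supp H) ≤ K * K := Nat.mul_le_mul hvK hvK
  rw [sq]; omega

/-! ### The two weight sums are `O(n^{-1})` -/

/-- **The I-sum is small**: for `p = n^{-ρ}`, `t = exp(-n^δ)`, `ρ + δ ≤ 2/k'`, `n ≥ 1`, `k ≥ 1`
and `log k'² ≤ n^δ`, the sum of the weights over the signatures of the non-empty graphs of
`I = smallI n k'` is `≤ k'(k'²+1) (2B)^{k'²} k^{k'} n^{-1}`. [folklore] -/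
theorem sum_sigWeight_smallI_le {n k k' : ℕ} (hn1 : 1 ≤ n) (hk1 : 1 ≤ k) {ρ δ : ℝ}
    (hρδ : ρ + δ ≤ 2 / (k' : ℝ)) (hlog : Real.log ((k' : ℝ) ^ 2) ≤ (n : ℝ) ^ δ) :
    ∑ σ ∈ ((smallI n k').filter fun H => 1 ≤ #(onSet H)).image sig,
        sigWeight n k ((n : ℝ) ^ (-ρ)) (tThr δ n) σ ≤
      ((k' * (k' ^ 2 + 1) : ℕ) : ℝ) * ((2 * spreadConst) ^ (k' ^ 2) * (k : ℝ) ^ k') *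
        (n : ℝ) ^ (-1 : ℝ) := by
  have hn' : (1 : ℝ) ≤ n := by exact_mod_cast hn1
  have hn0 : (0 : ℝ) < n := by linarith
  have hW : 0 ≤ (2 * spreadConst) ^ (k' ^ 2) * (k : ℝ) ^ k' := by
    have := spreadConst_pos; positivity
  have hWn : 0 ≤ (2 * spreadConst) ^ (k' ^ 2) * (k : ℝ) ^ k' * (n : ℝ) ^ (-1 : ℝ) :=
    mul_nonneg hW (Real.rpow_nonneg hn0.le _)
  have hcard : #(((smallI n k').filter fun H => 1 ≤ #(onSet H)).image sig) ≤ k' * (k' ^ 2 + 1) :=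
    card_image_sig_le_of_supp_lt fun H hH => by
      have := (mem_smallI H).1 (mem_filter.1 hH).1; omega
  calc ∑ σ ∈ ((smallI n k').filter fun H => 1 ≤ #(onSet H)).image sig,
        sigWeight n k ((n : ℝ) ^ (-ρ)) (tThr δ n) σ
      ≤ ∑ σ ∈ ((smallI n k').filter fun H => 1 ≤ #(onSet H)).image sig,
          (2 * spreadConst) ^ (k' ^ 2) * (k : ℝ) ^ k' * (n : ℝ) ^ (-1 : ℝ) := by
        refine sum_le_sum fun σ hσ => ?_
        obtain ⟨H, hH, rfl⟩ := mem_image.1 hσ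
        rw [mem_filter, mem_smallI] at hH
        have hvK : #(supp H) ≤ k' := by omega
        calc sigWeight n k ((n : ℝ) ^ (-ρ)) (tThr δ n) (sig H)
            ≤ (2 * spreadConst) ^ (k' ^ 2) * (k : ℝ) ^ k' *
                (n : ℝ) ^ ((ρ + δ) * #(onSet H) - #(supp H)) :=
              sigWeight_le_rpow hn1 hk1 hlog hH.2 (card_onSet_le_sq hvK) hvK
          _ ≤ _ := mul_le_mul_of_nonneg_left (Real.rpow_le_rpow_of_exponent_le hn'
              (exponent_smallI_le hρδ hH.2 (card_onSet_le_choose H) hvK)) hW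
    _ = #(((smallI n k').filter fun H => 1 ≤ #(onSet H)).image sig) *
          ((2 * spreadConst) ^ (k' ^ 2) * (k : ℝ) ^ k' * (n : ℝ) ^ (-1 : ℝ)) := by
        rw [sum_const, nsmul_eq_mul]
    _ ≤ ((k' * (k' ^ 2 + 1) : ℕ) : ℝ) *
          ((2 * spreadConst) ^ (k' ^ 2) * (k : ℝ) ^ k' * (n : ℝ) ^ (-1 : ℝ)) :=
        mul_le_mul_of_nonneg_right (by exact_mod_cast hcard) hWn
    _ = _ := by ring

/-- **The J-sum is small, even multiplied by the size bound `n^c`**: for `p = n^{-ρ}`,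
`t = exp(-n^δ)`, `ρ + δ ≤ 2/k'`, `4(c+1) ≤ k'`, `n ≥ 1`, `k ≥ 1` and `log k'² ≤ n^δ`,
`n^c · Σ_{σ ∈ sig(J)} W σ ≤ k'(k'²+1) (2B)^{k'²} k^{k'} n^{-1}` (the final count of §6 with `k'`
for `k`). [cite: Rossman2010, §6 (p. 9)] -/
theorem rpow_mul_sum_sigWeight_medJ_le {n k k' : ℕ} (hn1 : 1 ≤ n) (hk1 : 1 ≤ k) {ρ δ c : ℝ}
    (hρδ : ρ + δ ≤ 2 / (k' : ℝ)) (hck' : 4 * (c + 1) ≤ (k' : ℝ))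
    (hlog : Real.log ((k' : ℝ) ^ 2) ≤ (n : ℝ) ^ δ) :
    (n : ℝ) ^ c * ∑ σ ∈ (medJ n k').image sig, sigWeight n k ((n : ℝ) ^ (-ρ)) (tThr δ n) σ ≤
      ((k' * (k' ^ 2 + 1) : ℕ) : ℝ) * ((2 * spreadConst) ^ (k' ^ 2) * (k : ℝ) ^ k') *
        (n : ℝ) ^ (-1 : ℝ) := by
  have hn' : (1 : ℝ) ≤ n := by exact_mod_cast hn1
  have hn0 : (0 : ℝ) < n := by linarith
  have hW : 0 ≤ (2 * spreadConst) ^ (k' ^ 2) * (k : ℝ) ^ k' := by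
    have := spreadConst_pos; positivity
  have hWn : 0 ≤ (2 * spreadConst) ^ (k' ^ 2) * (k : ℝ) ^ k' * (n : ℝ) ^ (-1 : ℝ) :=
    mul_nonneg hW (Real.rpow_nonneg hn0.le _)
  rw [mul_sum]
  calc ∑ σ ∈ (medJ n k').image sig, (n : ℝ) ^ c * sigWeight n k ((n : ℝ) ^ (-ρ)) (tThr δ n) σ
      ≤ ∑ σ ∈ (medJ n k').image sig,
          (2 * spreadConst) ^ (k' ^ 2) * (k : ℝ) ^ k' * (n : ℝ) ^ (-1 : ℝ) := by
        refine sum_le_sum fun σ hσ => ?_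
        obtain ⟨H, hH, rfl⟩ := mem_image.1 hσ
        obtain ⟨hs1, hvk, hJ⟩ := medJ_ineq hH
        have hvK : #(supp H) ≤ k' := by omega
        have h1 := sigWeight_le_rpow (ρ := ρ) hn1 hk1 hlog hs1 (card_onSet_le_sq hvK) hvK
        have hexp := exponent_medJ_le (s := #(onSet H)) (v := #(supp H)) hρδ hck' hJ
        calc (n : ℝ) ^ c * sigWeight n k ((n : ℝ) ^ (-ρ)) (tThr δ n) (sig H)
            ≤ (n : ℝ) ^ c * ((2 * spreadConst) ^ (k' ^ 2) * (k : ℝ) ^ k' *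
                (n : ℝ) ^ ((ρ + δ) * #(onSet H) - #(supp H))) :=
              mul_le_mul_of_nonneg_left h1 (Real.rpow_nonneg hn0.le _)
          _ = (2 * spreadConst) ^ (k' ^ 2) * (k : ℝ) ^ k' *
                (n : ℝ) ^ (c + ((ρ + δ) * #(onSet H) - #(supp H))) := by
              rw [Real.rpow_add hn0]; ring
          _ ≤ _ := mul_le_mul_of_nonneg_left
              (Real.rpow_le_rpow_of_exponent_le hn' (by linarith)) hW
    _ = #((medJ n k').image sig) *
          ((2 * spreadConst) ^ (k' ^ 2) * (k : ℝ) ^ k' * (n : ℝ) ^ (-1 : ℝ)) := by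
        rw [sum_const, nsmul_eq_mul]
    _ ≤ ((k' * (k' ^ 2 + 1) : ℕ) : ℝ) *
          ((2 * spreadConst) ^ (k' ^ 2) * (k : ℝ) ^ k' * (n : ℝ) ^ (-1 : ℝ)) :=
        mul_le_mul_of_nonneg_right (by exact_mod_cast card_image_sig_medJ_le) hWn
    _ = _ := by ring

/-! ### The sparse-noise Theorem 1 -/

/-- **Rossman 2010, Theorem 1, sparse-noise variant** (sequence form; corollary of the finite
dichotomy `thm1_sparse_finite`, a variant of Theorem 1 whose I-count replacing Lemma 15 is not
in the source): let `5 ≤ k'`, `4(c+1) ≤ k' ≤ k`, `0 < ρ`, `0 < δ`, `ρ + δ ≤ 2/k'`, `0 < η`. Then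
for all sufficiently large `n`, every circuit `C` over `{∧₂, ∨₂, 0, 1}` on the edges of `Kₙ`
with `size C ≤ n^c` and `Pr_A[C(K_A) = 1] ≥ η` (`A` a uniformly random `k`-subset of `[n]`)
satisfies `Pr[C(G(n, n^{-ρ})) = 1] ≥ 1 - exp(-n^{δ/2})`. In words: small monotone circuits that
accept a constant fraction of the planted `k`-cliques accept pure noise of density `n^{-ρ}` for
every `ρ < 2/k'`, an exponent independent of `k` (Theorem 1: `ρ = 2(1+δ)/(k-1)`). Proof: at a
large `n` (`n^{-ρ} < 1/2`, `e^{-n^δ} ≤ 1/2`, `log k'² ≤ n^δ`,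
`k'(k'²+1)(2B)^{k'²}k^{k'} n^{-1} < η/2`, `2^{k'²} n^{c+k'} e^{-n^δ} ≤ e^{-n^{δ/2}}/2`) apply
`thm1_sparse_finite` with `p = n^{-ρ}`, `t = e^{-n^δ}`: the first alternative is excluded by
`sum_sigWeight_smallI_le`, `rpow_mul_sum_sigWeight_medJ_le`, and in the second
`size(C)·|I ∪ J|·t ≤ n^c · n^{k'} 2^{C(k',2)} · e^{-n^δ} ≤ e^{-n^{δ/2}}`.
[cite: Rossman2010, Thm 1 (p. 4; proof §6, pp. 8–9)] -/
theorem thm1_sparse {c ρ δ η : ℝ} {k k' : ℕ} (hk' : 5 ≤ k') (hck' : 4 * (c + 1) ≤ (k' : ℝ))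
    (hk'k : k' ≤ k) (hρ : 0 < ρ) (hδ : 0 < δ) (hρδ : ρ + δ ≤ 2 / (k' : ℝ)) (hη : 0 < η) :
    ∀ᶠ n : ℕ in atTop, ∀ C : Circuit ((⊤ : SimpleGraph (Fin n)).edgeSet),
      C.IsOver monotoneBasis01 → (C.size : ℝ) ≤ (n : ℝ) ^ c →
      η ≤ kSubsetProb n k (fun A => C.eval (cliqueVec A) = true) →
      1 - Real.exp (-((n : ℝ) ^ (δ / 2))) ≤
        gnpProb n ((n : ℝ) ^ (-ρ)) (univ.filter fun x => C.eval x = true) := by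
  have e1 := eventually_ge_atTop k
  have e2 : ∀ᶠ n : ℕ in atTop, (n : ℝ) ^ (-ρ) < 1 / 2 :=
    ((tendsto_rpow_neg_atTop hρ).comp tendsto_natCast_atTop_atTop).eventually
      (gt_mem_nhds (by norm_num : (0 : ℝ) < 1 / 2))
  have e3 := eventually_exp_neg_rpow_le hδ (by norm_num : (0 : ℝ) < 1 / 2)
  have e4 := eventually_const_le_rpow hδ (Real.log ((k' : ℝ) ^ 2))
  have e5 := eventually_mul_rpow_neg_lt (c := 1) one_pos (half_pos hη)
    (((k' * (k' ^ 2 + 1) : ℕ) : ℝ) * ((2 * spreadConst) ^ (k' ^ 2) * (k : ℝ) ^ k'))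
  have e6 := eventually_poly_mul_exp_le (A := (2 : ℝ) ^ (k' ^ 2)) (m := c + k') hδ
    (half_lt_self hδ)
  filter_upwards [e1, e2, e3, e4, e5, e6] with n hkn hp ht hlog hsum hexp C hC hsize hacc
  have hn0 : 0 < n := by omega
  have hn1 : 1 ≤ n := hn0
  have hnr : (0 : ℝ) < n := by exact_mod_cast hn0
  have hk1 : 1 ≤ k := by omega
  have hk'n : k' ≤ n := hk'k.trans hkn
  have hp0 : 0 < (n : ℝ) ^ (-ρ) := Real.rpow_pos_of_pos hnr _
  have hp1 : (n : ℝ) ^ (-ρ) ≤ 1 / 2 := hp.le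
  have ht0 : 0 < tThr δ n := Real.exp_pos _
  have ht1 : tThr δ n ≤ 1 / 2 := ht
  have htp : tThr δ n < 1 - (n : ℝ) ^ (-ρ) := by linarith
  rcases thm1_sparse_finite hk' hk'k hkn hp0 hp1 ht0 ht1 htp C hC with h | h
  · -- the count is too small: impossible when `Pr_A[C(K_A) = 1] ≥ η`
    exfalso
    have hI := sum_sigWeight_smallI_le (k := k) hn1 hk1 hρδ hlog
    have hJ := rpow_mul_sum_sigWeight_medJ_le (k := k) hn1 hk1 hρδ hck' hlog
    have hSJ0 : 0 ≤ ∑ σ ∈ (medJ n k').image sig, sigWeight n k ((n : ℝ) ^ (-ρ)) (tThr δ n) σ :=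
      sum_nonneg fun σ hσ => by
        obtain ⟨H, hH, rfl⟩ := mem_image.1 hσ
        exact sigWeight_nonneg hp0.le ht0 (by linarith) (medJ_ineq hH).1
    have h1 : (C.size : ℝ) * ∑ σ ∈ (medJ n k').image sig,
        sigWeight n k ((n : ℝ) ^ (-ρ)) (tThr δ n) σ ≤
        (n : ℝ) ^ c * ∑ σ ∈ (medJ n k').image sig,
          sigWeight n k ((n : ℝ) ^ (-ρ)) (tThr δ n) σ :=
      mul_le_mul_of_nonneg_right hsize hSJ0
    have := h.trans (add_le_add hI (h1.trans hJ))
    linarith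
  · -- `C̄ ≡ 1`: the error of Lemma 13 is a stretched exponential
    refine le_trans ?_ h
    have hKcard : (#(smallI n k' ∪ medJ n k') : ℝ) ≤ (n : ℝ) ^ (k' : ℝ) * (2 : ℝ) ^ (k' ^ 2) := by
      have h1 := card_smallI_union_medJ_le (n := n) hk'n
      have h2 : n.choose k' ≤ n ^ k' := Nat.choose_le_pow n k'
      have h3 : 2 ^ k'.choose 2 ≤ 2 ^ (k' ^ 2) := Nat.pow_le_pow_right (by norm_num)
        (by have := two_mul_choose_two_add k'; nlinarith)
      have : #(smallI n k' ∪ medJ n k') ≤ n ^ k' * 2 ^ (k' ^ 2) := h1.trans (Nat.mul_le_mul h2 h3)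
      have : (#(smallI n k' ∪ medJ n k') : ℝ) ≤ ((n ^ k' * 2 ^ (k' ^ 2) : ℕ) : ℝ) := by
        exact_mod_cast this
      rw [Real.rpow_natCast]; push_cast at this; exact this
    have hbound : (C.size : ℝ) * (#(smallI n k' ∪ medJ n k') * tThr δ n) ≤
        (2 : ℝ) ^ (k' ^ 2) * (n : ℝ) ^ (c + k') * Real.exp (-((n : ℝ) ^ δ)) := by
      have : (C.size : ℝ) * (#(smallI n k' ∪ medJ n k') * tThr δ n) ≤
          (n : ℝ) ^ c * ((n : ℝ) ^ (k' : ℝ) * (2 : ℝ) ^ (k' ^ 2) * tThr δ n) :=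
        mul_le_mul hsize (mul_le_mul_of_nonneg_right hKcard ht0.le)
          (mul_nonneg (Nat.cast_nonneg _) ht0.le) (Real.rpow_nonneg hnr.le _)
      refine this.trans (le_of_eq ?_)
      rw [Real.rpow_add hnr, tThr]; ring
    have hε := Real.exp_pos (-((n : ℝ) ^ (δ / 2)))
    linarith

/-- `thm1_sparse` for an integral size exponent `c : ℕ` and the size bound `size C ≤ n ^ c` in
`ℕ` (the form used for polynomial-size circuit families). [cite: Rossman2010, Thm 1 (p. 4)] -/
theorem thm1_sparse_natSize {c k k' : ℕ} {ρ δ η : ℝ} (hk' : 5 ≤ k') (hck' : 4 * (c + 1) ≤ k')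
    (hk'k : k' ≤ k) (hρ : 0 < ρ) (hδ : 0 < δ) (hρδ : ρ + δ ≤ 2 / (k' : ℝ)) (hη : 0 < η) :
    ∀ᶠ n : ℕ in atTop, ∀ C : Circuit ((⊤ : SimpleGraph (Fin n)).edgeSet),
      C.IsOver monotoneBasis01 → C.size ≤ n ^ c →
      η ≤ kSubsetProb n k (fun A => C.eval (cliqueVec A) = true) →
      1 - Real.exp (-((n : ℝ) ^ (δ / 2))) ≤
        gnpProb n ((n : ℝ) ^ (-ρ)) (univ.filter fun x => C.eval x = true) := by
  have hck'' : 4 * ((c : ℝ) + 1) ≤ (k' : ℝ) := by exact_mod_cast hck'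
  filter_upwards [thm1_sparse hk' hck'' hk'k hρ hδ hρδ hη] with n hn C hC hsize hacc
  refine hn C hC ?_ hacc
  rw [Real.rpow_natCast]
  exact_mod_cast hsize

end Literature.Computability.Complexity
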